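import Summits.QuantumFields.YangMills.Theorems.UnitScaleTiltTorusWrapHolonomies
import Summits.QuantumFields.YangMills.Theorems.UnitScaleTiltSU2NearCommuting
import HarnessLib

/-!
# `UnitScaleTiltToronGauge` — SMALL PLAQUETTES ON THE WHOLE TORUS ⇒ GAUGE-NEAR A TORON: a `δ`-flat `SU(2)` configuration on `T^{(j)}` is, after ONE gauge
# transformation, bondwise `O(N²δ)`-close to the constant diagonal field `b ↦ diag(e^{iθ_μ∕N}, e^{−iθ_μ∕N})` off the wrap bonds and `O(N²δ) + 2(O(N²δ))^{1∕3}`-close on them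
# (route `UnitScaleTilt`, crux K1′ `MinimiserStabilityRegPr` stmt-QuantumFields-19200, small-member exit (α)(a), piece P3 «`RegPr` ↦ toron gauge», FILE 3 of 3)

Cell `ym3-torus` (YM ladder rung R3 = continuum SU(2) Yang–Mills on T³ — a RUNG, NOT the Clay problem: not d = 4, not infinite volume,
not a mass gap); width seat `ym3-torus-px19` (gen 12); helper `--supports stmt-QuantumFields-19200`.  THEOREMS ONLY (0 `def`, 0 `sorry`, default
heartbeats), any dimension `P.d`, any level `j`; the two earlier files BY NAME: ✓`TorusWrapHolonomies.exists_gauge_wrap_rows` (FILE 1: the whole-torus axial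
gauge — non-wrap bonds `A`-small, parallel wrap variables `B`-close, corner holonomies `C`-commuting, `A = (d−1)(N−1)δ`, `B = 2(d−1)(N−1)(δ+2A)`,
`C = δ + 2(N−1)(δ+2A)`) and ✓`SU2NearCommuting.exists_conj_near_diagonal` (FILE 2: `C ≤ t³` ⇒ one `W ∈ SU(2)` puts the `d` corner holonomies `2t`-near diagonal
elements `D(θ_μ) = quatToSU2 (cos θ_μ + sin θ_μ·i)`).

THE GAUGE.  `σ := (x ↦ D(φ(x))) · W · σ_axial` with the ABELIAN SPREADING PHASE `φ(x) := −(Σ_ν θ_ν · x_ν)∕N` on representatives `x_ν ∈ [0, N)` (`ZMod.val`).  Since the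
`D(·)` form a one-parameter group (§1: `D_mul`, `D_zero`, `D_inv`), on a NON-WRAP bond `⟨x, μ⟩` (`x_μ ≠ N − 1`) the phase drops by exactly `θ_μ∕N`, so
`U^σ(b)·D(θ_μ∕N)⁻¹ = D(φ(x))·(W U^{ax}(b) W⁻¹)·D(φ(x))⁻¹` and `dist1 = dist1 (U^{ax} b) ≤ A` (conjugation invariance); on a WRAP bond (`x_μ = N − 1 ↦ 0`) the phase jumps by
`+θ_μ(N−1)∕N`, so `U^σ(b)·D(θ_μ∕N)⁻¹ = D(φ(x))·(W U^{ax}(b) W⁻¹·D(θ_μ)⁻¹)·D(φ(x))⁻¹` and `dist1 ≤ B + 2t` (the wrap variable is `B`-close to its corner representative,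
which `W` put `2t`-near `D(θ_μ)`).

* §1 ★`dq_mul` ∕ `su2Quat_D` ∕ ★`D_mul` ∕ `D_zero` ∕ `D_inv` — the diagonal torus `θ ↦ D(θ)` is a homomorphism `ℝ → SU(2)`; `D_conj_cancel`∕`D_conj_cancel'` (the phase algebra on a bond);
* §2 ★`sum_weights_shift` (the phase step along a bond; the representative of `x_μ + 1` is `val x_μ + 1` off the wrap coordinate and `0` on it);
* §3 ★★★`exists_toron_gauge` — for `U : GaugeField P j SU(2)`, `PlaqSmall δ U`, `0 ≤ δ`, `0 ≤ t`, `C ≤ t³`: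
  `∃ σ θ, PlaqSmall δ U^σ ∧ (∀ μ, |θ_μ| ≤ π) ∧ (∀ b, x_μ ≠ −1 → dist1 (U^σ b · D(θ_{μ}∕N)⁻¹) ≤ A) ∧ (∀ b, x_μ = −1 → dist1 (U^σ b · D(θ_{μ}∕N)⁻¹) ≤ B + 2t)` (angles recentred into `(−π, π]` by `toIocMod`).

K-UNIFORMITY for the (α)(a) member `(F, n, K)`: `N = 2L^{m+K}`, `δ = ε₀L^{−2(K−n)}`, so `A, B, C = O(ε₀L^{2(m+n)})` and `t = C^{1∕3}` — NO `K`; the `(N²δ)^{1∕3}` defect sits on the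
wrap bonds only (one per lattice line and direction).  HONEST SCOPE.  Lattice-gauge + compact-group bookkeeping; nothing of (α)(a)'s twisted coercivity, `hT`, `hGF`, EX,
`MinimiserStabilityRegPr` (19200) or the rung `YM3TorusSU2` is proved; no summit statement is proved; the Yang–Mills mass gap is NOT proved.
References: [Balaban1985Averaging] (8)–(9) p. 19, (19) p. 21, p. 24; [BrockerTomDieck1985] IV (2.2).
-/

noncomputable section

set_option autoImplicit false

open Quaternion
open Literature.MathematicalPhysics.QuantumLattice (su2Quat quatToSU2 norm_su2Quat quatToSU2_su2Quat)
open Literature.MathematicalPhysics.QuantumFieldTheory.Balaban1983to89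
open Literature.MathematicalPhysics.QuantumFieldTheory.Balaban1983to89.T4HaarSU2Translate (su2Quat_mul su2Quat_one su2Quat_quatToSU2)
open Literature.MathematicalPhysics.QuantumFieldTheory.Balaban1983to89.T4CubeChartGnomonic (SU2)
open Literature.MathematicalPhysics.QuantumFieldTheory.Balaban1983to89.T4ReTrLipUnitary (plaqSmall_gaugeAct_iff)
open Literature.MathematicalPhysics.QuantumFieldTheory.Balaban1983to89.B15.PrelimIntegrations (dist1_fluct_le)
open Summit.QuantumFields.YangMills.Theorems.TorusWrapHolonomies (exists_gauge_wrap_rows natCast_pred_sitesPerDir)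
open Summit.QuantumFields.YangMills.Theorems.SU2NearCommuting (exists_conj_near_diagonal)
open scoped BigOperators

namespace Summit.QuantumFields.YangMills.Theorems.ToronGauge

variable {P : Params} {j : ℕ}

/-! ## §1 The diagonal torus `θ ↦ D(θ) = quatToSU2 (cos θ + sin θ·i)` is a one-parameter group -/

/-- ★ `(cos a + sin a·i)(cos b + sin b·i) = cos(a+b) + sin(a+b)·i` in `ℍ`. [cite: BrockerTomDieck1985, IV (2.2)] -/
theorem dq_mul (a b : ℝ) :
    (⟨Real.cos a, Real.sin a, 0, 0⟩ : ℍ) * ⟨Real.cos b, Real.sin b, 0, 0⟩ = ⟨Real.cos (a + b), Real.sin (a + b), 0, 0⟩ := by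
  ext
  · simp [Real.cos_add]; ring
  · simp [Real.sin_add]; ring
  · simp
  · simp

/-- The unit quaternion of `D(a)` is `cos a + sin a·i`. [cite: BrockerTomDieck1985, I (1.10)] -/
theorem su2Quat_D (a : ℝ) : su2Quat (quatToSU2 ⟨Real.cos a, Real.sin a, 0, 0⟩) = ⟨Real.cos a, Real.sin a, 0, 0⟩ := by
  set dq : ℍ := ⟨Real.cos a, Real.sin a, 0, 0⟩ with hdq
  have h1 : ‖dq‖ = 1 := by
    have h : ‖dq‖ ^ 2 = 1 := by
      rw [sq, ← Quaternion.normSq_eq_norm_mul_self, Quaternion.normSq_def', hdq]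
      simp only
      nlinarith [Real.cos_sq_add_sin_sq a]
    nlinarith [norm_nonneg dq]
  have h0 : dq ≠ 0 := by intro h; rw [h, norm_zero] at h1; exact zero_ne_one h1
  rw [su2Quat_quatToSU2 h0, h1, inv_one, one_smul]

/-- ★ `D(a)·D(b) = D(a + b)`. [cite: BrockerTomDieck1985, IV (2.2)] -/
theorem D_mul (a b : ℝ) :
    quatToSU2 ⟨Real.cos a, Real.sin a, 0, 0⟩ * quatToSU2 ⟨Real.cos b, Real.sin b, 0, 0⟩
      = quatToSU2 ⟨Real.cos (a + b), Real.sin (a + b), 0, 0⟩ := by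
  have h : su2Quat (quatToSU2 ⟨Real.cos a, Real.sin a, 0, 0⟩ * quatToSU2 ⟨Real.cos b, Real.sin b, 0, 0⟩)
      = su2Quat (quatToSU2 ⟨Real.cos (a + b), Real.sin (a + b), 0, 0⟩) := by
    rw [su2Quat_mul, su2Quat_D, su2Quat_D, su2Quat_D]
    exact dq_mul a b
  rw [← quatToSU2_su2Quat (quatToSU2 ⟨Real.cos a, Real.sin a, 0, 0⟩ * quatToSU2 ⟨Real.cos b, Real.sin b, 0, 0⟩), h, quatToSU2_su2Quat]

/-- `D(0) = 1`. [cite: BrockerTomDieck1985, IV (2.2)] -/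
theorem D_zero : quatToSU2 ⟨Real.cos 0, Real.sin 0, 0, 0⟩ = (1 : SU2) := by
  have h : su2Quat (quatToSU2 ⟨Real.cos 0, Real.sin 0, 0, 0⟩) = su2Quat (1 : SU2) := by
    rw [su2Quat_D, su2Quat_one, Real.cos_zero, Real.sin_zero]
    rfl
  rw [← quatToSU2_su2Quat (quatToSU2 ⟨Real.cos 0, Real.sin 0, 0, 0⟩), h, quatToSU2_su2Quat]

/-- `D(a)⁻¹ = D(−a)`. [cite: BrockerTomDieck1985, IV (2.2)] -/
theorem D_inv (a : ℝ) : (quatToSU2 ⟨Real.cos a, Real.sin a, 0, 0⟩)⁻¹ = quatToSU2 ⟨Real.cos (-a), Real.sin (-a), 0, 0⟩ := by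
  symm
  apply eq_inv_of_mul_eq_one_left
  rw [D_mul, neg_add_cancel, D_zero]

/-- The spreading phase on a NON-WRAP bond: `D(a)·X·D(b)⁻¹·D(c)⁻¹ = D(a)·X·D(a)⁻¹` when `b = a − c`. [cite: BrockerTomDieck1985, IV (2.2)] -/
theorem D_conj_cancel (a b c : ℝ) (X : SU2) (h : b = a - c) :
    quatToSU2 ⟨Real.cos a, Real.sin a, 0, 0⟩ * X * (quatToSU2 ⟨Real.cos b, Real.sin b, 0, 0⟩)⁻¹
        * (quatToSU2 ⟨Real.cos c, Real.sin c, 0, 0⟩)⁻¹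
      = quatToSU2 ⟨Real.cos a, Real.sin a, 0, 0⟩ * X * (quatToSU2 ⟨Real.cos a, Real.sin a, 0, 0⟩)⁻¹ := by
  rw [h, mul_assoc (quatToSU2 ⟨Real.cos a, Real.sin a, 0, 0⟩ * X), ← mul_inv_rev, D_mul,
    show c + (a - c) = a by ring]

/-- The spreading phase on a WRAP bond: `D(a)·X·D(b)⁻¹·D(c)⁻¹ = D(a)·(X·D(e)⁻¹)·D(a)⁻¹` when `b = a + e − c`. [cite: BrockerTomDieck1985, IV (2.2)] -/
theorem D_conj_cancel' (a b c e : ℝ) (X : SU2) (h : b = a + e - c) :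
    quatToSU2 ⟨Real.cos a, Real.sin a, 0, 0⟩ * X * (quatToSU2 ⟨Real.cos b, Real.sin b, 0, 0⟩)⁻¹
        * (quatToSU2 ⟨Real.cos c, Real.sin c, 0, 0⟩)⁻¹
      = quatToSU2 ⟨Real.cos a, Real.sin a, 0, 0⟩ * (X * (quatToSU2 ⟨Real.cos e, Real.sin e, 0, 0⟩)⁻¹)
          * (quatToSU2 ⟨Real.cos a, Real.sin a, 0, 0⟩)⁻¹ := by
  rw [h, mul_assoc (quatToSU2 ⟨Real.cos a, Real.sin a, 0, 0⟩ * X), ← mul_inv_rev, D_mul,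
    show c + (a + e - c) = a + e by ring, ← D_mul, mul_inv_rev, ← mul_assoc, mul_assoc (quatToSU2 ⟨Real.cos a, Real.sin a, 0, 0⟩)]

/-! ## §2 Torus bookkeeping: the step of the spreading phase along a bond -/

/-- ★ **THE PHASE STEP**: along the bond `⟨x, μ⟩` the weighted representative sum changes only in the coordinate `μ`:
`Σ_ν θ_ν·val((x+e_μ)_ν) = Σ_ν θ_ν·val(x_ν) + θ_μ·(val(x_μ + 1) − val(x_μ))`. [folklore] -/
theorem sum_weights_shift (θ : Fin P.d → ℝ) (x : Site P j) (μ : Fin P.d) :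
    ∑ ν, θ ν * (((x.shift μ) ν).val : ℝ) = ∑ ν, θ ν * ((x ν).val : ℝ) + θ μ * ((((x μ + 1).val : ℕ) : ℝ) - ((x μ).val : ℝ)) := by
  have key : ∀ c : ZMod (P.sitesPerDir j),
      ∑ ν, θ ν * (((Function.update x μ c : Site P j) ν).val : ℝ) = θ μ * (c.val : ℝ) + ∑ ν ∈ (Finset.univ : Finset (Fin P.d)).erase μ, θ ν * ((x ν).val : ℝ) := by
    intro c
    rw [← Finset.add_sum_erase _ _ (Finset.mem_univ μ), Function.update_self]
    congr 1
    exact Finset.sum_congr rfl fun ν hν => by rw [Function.update_of_ne (Finset.ne_of_mem_erase hν)]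
  have h1 := key (x μ + 1)
  have h0 := key (x μ)
  rw [Function.update_eq_self] at h0
  rw [show x.shift μ = Function.update x μ (x μ + 1) from rfl, h1, h0]
  ring

/-! ## §3 The toron gauge -/

/-- ★★★ **SMALL PLAQUETTES ⇒ GAUGE-NEAR A TORON, ON THE WHOLE TORUS.**  For `U : GaugeField P j SU(2)` with `PlaqSmall δ U` (`0 ≤ δ`), `N = sitesPerDir j`,
`A := (d−1)(N−1)δ`, `B := 2(d−1)(N−1)(δ+2A)`, `C := δ + 2(N−1)(δ+2A)` and any `t ≥ 0` with `C ≤ t³`, there are a gauge `σ` and angles `θ : Fin d → ℝ`, `|θ_μ| ≤ π`, such that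
`U^σ` is `δ`-flat and, against the TORON `b ↦ D(θ_{b.dir}∕N)` (`D(θ) = quatToSU2 (cos θ + sin θ·i) = diag(e^{iθ}, e^{−iθ})`): every NON-WRAP bond (`x_μ ≠ −1`) has
`dist1 (U^σ b · D(θ_μ∕N)⁻¹) ≤ A` and every WRAP bond (`x_μ = −1`) has `dist1 (U^σ b · D(θ_μ∕N)⁻¹) ≤ B + 2t`.
`σ = (x ↦ D(−Σ_ν θ_ν val(x_ν)∕N)) · W · σ_axial` (FILE 1's axial gauge, FILE 2's conjugator, the abelian spreading phase). [cite: Balaban1985Averaging, (8)-(9) p.19, p.24] -/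
theorem exists_toron_gauge (U : GaugeField P j SU2) {δ t : ℝ} (hδ : 0 ≤ δ) (ht : 0 ≤ t) (hU : PlaqSmall δ U)
    (hC : δ + 2 * (((P.sitesPerDir j - 1 : ℕ) : ℝ) * (δ + 2 * (((P.d - 1 : ℕ) : ℝ) * ((P.sitesPerDir j - 1 : ℕ) : ℝ) * δ))) ≤ t ^ 3) :
    ∃ (σ : GaugeTransf P j SU2) (θ : Fin P.d → ℝ),
      PlaqSmall δ (GaugeField.gaugeAct σ U) ∧ (∀ μ, |θ μ| ≤ Real.pi) ∧
      (∀ b : PBond P j, b.src b.dir ≠ -1 →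
        dist1 (GaugeField.gaugeAct σ U b *
            (quatToSU2 ⟨Real.cos (θ b.dir / P.sitesPerDir j), Real.sin (θ b.dir / P.sitesPerDir j), 0, 0⟩)⁻¹)
          ≤ ((P.d - 1 : ℕ) : ℝ) * ((P.sitesPerDir j - 1 : ℕ) : ℝ) * δ) ∧
      (∀ b : PBond P j, b.src b.dir = -1 →
        dist1 (GaugeField.gaugeAct σ U b *
            (quatToSU2 ⟨Real.cos (θ b.dir / P.sitesPerDir j), Real.sin (θ b.dir / P.sitesPerDir j), 0, 0⟩)⁻¹)
          ≤ 2 * (((P.d - 1 : ℕ) : ℝ) * ((P.sitesPerDir j - 1 : ℕ) : ℝ)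
                * (δ + 2 * (((P.d - 1 : ℕ) : ℝ) * ((P.sitesPerDir j - 1 : ℕ) : ℝ) * δ))) + 2 * t) := by
  classical
  obtain ⟨σ₁, hflat, hbox, hpar, hcomm⟩ := exists_gauge_wrap_rows U hδ hU
  -- the corner holonomies of the axial gauge
  set z : Site P j := fun _ => (0 : ZMod (P.sitesPerDir j)) with hz
  set h : Fin P.d → SU2 := fun μ => GaugeField.gaugeAct σ₁ U ⟨Function.update z μ (-1), μ⟩ with hh
  have hc : ∀ μ κ, dist1 (h μ * h κ * (h μ)⁻¹ * (h κ)⁻¹) ≤ t ^ 3 := by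
    intro μ κ
    rcases lt_trichotomy μ κ with hlt | heq | hgt
    · exact (hcomm μ κ hlt z rfl rfl).trans hC
    · subst heq
      rw [mul_inv_cancel_right, mul_inv_cancel, GaugeGroup.dist1_one]
      positivity
    · have e : h μ * h κ * (h μ)⁻¹ * (h κ)⁻¹ = (h κ * h μ * (h κ)⁻¹ * (h μ)⁻¹)⁻¹ := by group
      rw [e, GaugeGroup.dist1_inv]
      exact (hcomm κ μ hgt z rfl rfl).trans hC
  obtain ⟨W, θ₀, hW₀⟩ := exists_conj_near_diagonal h ht hc
  -- recentre the angles into `(−π, π]` (the torus element only sees `cos θ`, `sin θ`)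
  set θ : Fin P.d → ℝ := fun μ => toIocMod Real.two_pi_pos (-Real.pi) (θ₀ μ) with hθ
  have hθpi : ∀ μ, |θ μ| ≤ Real.pi := fun μ => by
    have hm := toIocMod_mem_Ioc Real.two_pi_pos (-Real.pi) (θ₀ μ)
    rw [abs_le]
    constructor <;> linarith [hm.1, hm.2]
  have hW : ∀ μ, dist1 (W * h μ * W⁻¹ * (quatToSU2 ⟨Real.cos (θ μ), Real.sin (θ μ), 0, 0⟩)⁻¹) ≤ 2 * t := fun μ => by
    have hc' : Real.cos (θ μ) = Real.cos (θ₀ μ) := by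
      simp only [hθ]
      rw [← self_sub_toIocDiv_zsmul Real.two_pi_pos (-Real.pi) (θ₀ μ), zsmul_eq_mul, Real.cos_sub_int_mul_two_pi]
    have hs' : Real.sin (θ μ) = Real.sin (θ₀ μ) := by
      simp only [hθ]
      rw [← self_sub_toIocDiv_zsmul Real.two_pi_pos (-Real.pi) (θ₀ μ), zsmul_eq_mul, Real.sin_sub_int_mul_two_pi]
    rw [hc', hs']
    exact hW₀ μ
  clear_value θ
  -- the spreading phase
  have h2N : 2 ≤ P.sitesPerDir j := by
    have h := Nat.one_le_pow (P.m + P.K - j) P.L P.L_pos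
    show 2 ≤ 2 * P.L ^ (P.m + P.K - j)
    omega
  have hN0 : ((P.sitesPerDir j : ℕ) : ℝ) ≠ 0 := by positivity
  set φ : Site P j → ℝ := fun x => -(∑ ν, θ ν * ((x ν).val : ℝ)) / ((P.sitesPerDir j : ℕ) : ℝ) with hφ
  have hform : ∀ b : PBond P j,
      GaugeField.gaugeAct (fun x => quatToSU2 ⟨Real.cos (φ x), Real.sin (φ x), 0, 0⟩ * W * σ₁ x) U b
        = quatToSU2 ⟨Real.cos (φ b.src), Real.sin (φ b.src), 0, 0⟩ * (W * GaugeField.gaugeAct σ₁ U b * W⁻¹)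
          * (quatToSU2 ⟨Real.cos (φ b.tgt), Real.sin (φ b.tgt), 0, 0⟩)⁻¹ := fun b => by
    simp only [GaugeField.gaugeAct, mul_inv_rev, mul_assoc]
  refine ⟨fun x => quatToSU2 ⟨Real.cos (φ x), Real.sin (φ x), 0, 0⟩ * W * σ₁ x, θ, (plaqSmall_gaugeAct_iff δ _ U).mpr hU, hθpi, ?_, ?_⟩
  · -- NON-WRAP bonds: the phase drops by `θ_μ ∕ N`
    intro b hb
    have hstep : φ b.tgt = φ b.src - θ b.dir / ((P.sitesPerDir j : ℕ) : ℝ) := by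
      have hval : (b.src b.dir + 1).val = (b.src b.dir).val + 1 := by
        have hlt := ZMod.val_lt (b.src b.dir)
        have hne : (b.src b.dir).val ≠ P.sitesPerDir j - 1 := fun hv =>
          hb (by rw [← ZMod.natCast_zmod_val (b.src b.dir), hv, natCast_pred_sitesPerDir])
        rw [ZMod.val_add, ZMod.val_one_eq_one_mod, Nat.mod_eq_of_lt (by omega : 1 < P.sitesPerDir j), Nat.mod_eq_of_lt (by omega)]
      simp only [hφ, PBond.tgt]
      rw [sum_weights_shift, hval]
      push_cast
      field_simp
      ring
    rw [hform b, D_conj_cancel _ _ _ _ hstep, GaugeGroup.dist1_conj, GaugeGroup.dist1_conj]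
    exact hbox b hb
  · -- WRAP bonds: the phase jumps by `+ θ_μ (N − 1) ∕ N`
    intro b hb
    have hv : ((b.src b.dir).val : ℝ) = ((P.sitesPerDir j : ℕ) : ℝ) - 1 := by
      have h1 : (b.src b.dir).val = P.sitesPerDir j - 1 := by
        rw [hb, ← natCast_pred_sitesPerDir, ZMod.val_natCast, Nat.mod_eq_of_lt (by omega)]
      rw [h1, Nat.cast_sub (by omega), Nat.cast_one]
    have hv0 : (b.src b.dir + 1).val = 0 := by rw [hb, neg_add_cancel, ZMod.val_zero]
    have hstep : φ b.tgt = φ b.src + θ b.dir - θ b.dir / ((P.sitesPerDir j : ℕ) : ℝ) := by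
      simp only [hφ, PBond.tgt]
      rw [sum_weights_shift, hv0, hv]
      push_cast
      field_simp
      ring
    rw [hform b, D_conj_cancel' _ _ _ _ _ hstep, GaugeGroup.dist1_conj]
    -- triangle through the conjugated corner holonomy `W h_μ W⁻¹`
    have hx : b.src b.dir = (Function.update z b.dir (-1) : Site P j) b.dir := by rw [Function.update_self]; exact hb
    have h1 : dist1 (W * GaugeField.gaugeAct σ₁ U b * W⁻¹ * (W * h b.dir * W⁻¹)⁻¹)
        ≤ 2 * (((P.d - 1 : ℕ) : ℝ) * ((P.sitesPerDir j - 1 : ℕ) : ℝ) * (δ + 2 * (((P.d - 1 : ℕ) : ℝ) * ((P.sitesPerDir j - 1 : ℕ) : ℝ) * δ))) := by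
      have e : W * GaugeField.gaugeAct σ₁ U b * W⁻¹ * (W * h b.dir * W⁻¹)⁻¹ = W * (GaugeField.gaugeAct σ₁ U b * (h b.dir)⁻¹) * W⁻¹ := by
        group
      rw [e, GaugeGroup.dist1_conj]
      obtain ⟨x, μ⟩ := b
      exact hpar μ x (Function.update z μ (-1)) hx
    have h2 := hW b.dir
    linarith [dist1_fluct_le (W * GaugeField.gaugeAct σ₁ U b * W⁻¹) (W * h b.dir * W⁻¹)
      (quatToSU2 ⟨Real.cos (θ b.dir), Real.sin (θ b.dir), 0, 0⟩)]

end Summit.QuantumFields.YangMills.Theorems.ToronGauge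

end
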